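import Literature.AlgebraicGeometry.Resolution.CartierDivisorControlledTransform
import Literature.AlgebraicGeometry.Resolution.ColonIdealSheafFG
import Literature.AlgebraicGeometry.Resolution.BlowupChartMembership
import Literature.AlgebraicGeometry.Resolution.RegularLocalOrder
import Literature.AlgebraicGeometry.Resolution.MarkedIdealsLemmas
import HarnessLib

/-!
# Crux `PatchingRelPerfect` (stmt-ResolutionOfSingularities-16161), chain W5.2 — TargetsF6 bookkeeping (B1)+(B2):
# PEEL = blowing up a Cartier centre is the identity; its controlled transforms and the order drop

[OURS · L1 W5.2 · F6 bookkeeping] res-L1-w52-plan-1 g8 STEER 2 (2026-08-27T10:04:06Z) (iii), split with res-D-pv-021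
(10:06:26Z: (B3) `IsFlagSeq.flagState₃` is hers).  PEEL steps occur in stage 1 (res-type-049's `StageOnePrephase₃`: centre = a
regular surface `S` of multiplicity `≥ 2` in `𝔟` and `≥ 1` in `R₁`, weight 2) and in stage 2 (res-L1-w52-stub-1's Phase B of
`SeparationBoundary₃`, weight 1).  In the chain's vocabulary such a step is `IsFlagSeq.cons` / `IsSepSeq.cons` with centre
`C = S` an EFFECTIVE CARTIER ideal sheaf and blowing up `τ = 𝟙 E` — legal because:

* (B1) **the identity is a blowing up along any effective Cartier centre** — this is ALREADY the tree's
  `Literature.AlgebraicGeometry.Resolution.IsBlowup.id : IsEffectiveCartier I → IsBlowup (𝟙 X) I` (`Resolution/Blowups`); no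
  new declaration is needed and none is made (consumers: `IsFlagSeq.cons (𝟙 E') … (IsBlowup.id hS)`);
* (B2) **the PEEL computation**: along `𝟙 E` the controlled transform of weight `m` is the colon ideal `(𝔟 : S^m)`
  (`controlledTransform_id_eq_colon_pow`), contains `𝔟` (`le_controlledTransform_id`), and for `𝔟 ≤ S^m` satisfies
  **`S ^ m * controlledTransform (𝟙 E) S 𝔟 m = 𝔟`** (`pow_mul_controlledTransform_id`, from the tree's
  `IsBlowup.pow_mul_controlledTransform_eq`) — weight-two instance `sq_mul_controlledTransform_id_two` (the weight-one toolkit is res-L1-w52-stub-1's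
  `…DepthSepPeelStep`, p521900: `DepthSep.controlledTransform_id`, `colon_mul_of_isEffectiveCartier`); it is non-zero / effective Cartier when `𝔟` is (`controlledTransform_id_ne_bot`,
  `isEffectiveCartier_controlledTransform_id`, the latter by (L-A) `IsBlowup.isEffectiveCartier_controlledTransform_of_le_pow`);
* (B2, orders) at a point `x` with regular local ring, if `ord_x S = w` then **`ord_x 𝔟 = m·w + ord_x (𝔟 : S^m)`**
  (`idealOrder_eq_add_of_pow_mul_eq`, the order function of a regular local ring being a valuation:
  `Resolution.mul_not_mem_pow_of_not_mem_pow` / `pow_not_mem_pow_of_not_mem_pow`), whence the ORDER DROP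
  `idealOrder_controlledTransform_id : ord_x (controlledTransform (𝟙 E) S 𝔟 m) = ord_x 𝔟 − m·w` (with `m·w ≤ ord_x 𝔟`); at a
  point of a regular hypersurface `S` (`w = 1`) the order drops by exactly the weight `m` (`…_of_order_one`).

Fact-free, folklore; nothing here is a statement of the manuscript under review (AI-written, weaker than expert review).  Independent
of the TargetsF6 definitions module (usable before it lands).

## References
* E. Bierstone, D. Grigoriev, P. Milman, J. Włodarczyk, *Effective Hironaka resolution and its complexity*, Asian J. Math. 15
  (2011), §3.2 Lemma 3.2.1 (controlled transform along an invertible exceptional ideal). [BierstoneGrigorievMilmanWlodarczyk2011]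
* O. Zariski, P. Samuel, *Commutative Algebra* II (1960), Ch. VIII §1 Thm. 1 (order valuation of a regular local ring).
  [ZariskiSamuel1960]
* U. Görtz, T. Wedhorn, *Algebraic Geometry I*, 2nd ed. (2020), remark after Def. 13.90 (blowing up a Cartier divisor).
  [GortzWedhorn2020]
-/

-- `Summit.<Summit>.<Sub>.Theorems` with `Sub = Summit` (single-conjunct summit, D-0017)
set_option linter.dupNamespace false

noncomputable section

open CategoryTheory AlgebraicGeometry TopologicalSpace IsLocalRing
open Literature.AlgebraicGeometry.Resolution
open Scheme.IdealSheafData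

namespace Summit.ResolutionOfSingularities.ResolutionOfSingularities.Theorems.DepthPeel

universe u

variable {E : Scheme.{u}} {S 𝔟 : E.IdealSheafData} {m : ℕ}

/-! ## §1 (B1)/(B2) Controlled transforms along the identity (PEEL steps; `IsBlowup.id`) -/

/-- Along the identity the controlled transform of weight `m` is the colon ideal `(𝔟 : S^m)`. [folklore] -/
theorem controlledTransform_id_eq_colon_pow (S 𝔟 : E.IdealSheafData) (m : ℕ) :
    controlledTransform (𝟙 E) S 𝔟 m = colon 𝔟 (S ^ m) := by
  rw [controlledTransform, Scheme.IdealSheafData.comap_id, Scheme.IdealSheafData.comap_id]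

/-- `𝔟 ≤ (𝔟 : S^m)`: a PEEL step only enlarges the ideal. [folklore] -/
theorem le_controlledTransform_id : 𝔟 ≤ controlledTransform (𝟙 E) S 𝔟 m := by
  simpa only [Scheme.IdealSheafData.comap_id] using comap_le_controlledTransform (𝟙 E) S 𝔟 m

/-- A PEEL transform of a non-zero ideal is non-zero. [folklore] -/
theorem controlledTransform_id_ne_bot (h𝔟 : 𝔟 ≠ ⊥) : controlledTransform (𝟙 E) S 𝔟 m ≠ ⊥ :=
  fun h => h𝔟 (le_bot_iff.mp (h ▸ le_controlledTransform_id))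

/-- **(B2) The PEEL computation**: for an effective Cartier `S` and `𝔟 ≤ S^m`,
`S ^ m * controlledTransform (𝟙 E) S 𝔟 m = 𝔟` (BGMW Lemma 3.2.1 (2) for the blowing up `𝟙 E` of the Cartier centre `S`,
tree `IsBlowup.id` + `IsBlowup.pow_mul_controlledTransform_eq`). [cite: BierstoneGrigorievMilmanWlodarczyk2011, §3.2 Lemma 3.2.1] -/
theorem pow_mul_controlledTransform_id (hS : IsEffectiveCartier S) (h : 𝔟 ≤ S ^ m) :
    S ^ m * controlledTransform (𝟙 E) S 𝔟 m = 𝔟 := by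
  have h' : 𝔟.comap (𝟙 E) ≤ S.comap (𝟙 E) ^ m := by
    simpa only [Scheme.IdealSheafData.comap_id] using h
  simpa only [Scheme.IdealSheafData.comap_id] using (IsBlowup.id hS).pow_mul_controlledTransform_eq h'

/-- Weight-two instance (stage 1 PEEL): `S ^ 2 * controlledTransform (𝟙 E) S 𝔟 2 = 𝔟` for `𝔟 ≤ S²`.
[cite: BierstoneGrigorievMilmanWlodarczyk2011, §3.2 Lemma 3.2.1] -/
theorem sq_mul_controlledTransform_id_two (hS : IsEffectiveCartier S) (h : 𝔟 ≤ S ^ 2) :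
    S ^ 2 * controlledTransform (𝟙 E) S 𝔟 2 = 𝔟 :=
  pow_mul_controlledTransform_id hS h

/-- The PEEL transform of an effective Cartier `𝔟 ≤ S^m` (`S` effective Cartier) is effective Cartier ((L-A) along `𝟙 E`).
[cite: Kollar2007, 3.30.2] -/
theorem isEffectiveCartier_controlledTransform_id (hS : IsEffectiveCartier S) (h𝔟 : IsEffectiveCartier 𝔟)
    (h : 𝔟 ≤ S ^ m) : IsEffectiveCartier (controlledTransform (𝟙 E) S 𝔟 m) :=
  (IsBlowup.id hS).isEffectiveCartier_controlledTransform_of_le_pow h𝔟 h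

/-- Iterating PEEL steps: `((𝔟 : S^m) : S^m') = (𝔟 : S^(m+m'))` — peeling `m` and then `m'` copies of `S` is peeling
`m + m'` copies. [folklore] -/
theorem controlledTransform_id_controlledTransform_id (S 𝔟 : E.IdealSheafData) (m m' : ℕ) :
    controlledTransform (𝟙 E) S (controlledTransform (𝟙 E) S 𝔟 m) m' = controlledTransform (𝟙 E) S 𝔟 (m + m') := by
  simp only [controlledTransform_id_eq_colon_pow]
  apply le_antisymm
  · rw [le_colon_iff, pow_add, mul_assoc]
    exact (mul_le_mul_right (mul_colon_le _ _) _).trans (mul_colon_le _ _)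
  · rw [le_colon_iff, le_colon_iff, ← mul_assoc, ← pow_add, add_comm]
    exact mul_colon_le _ _

/-! ## §2 (B2, orders) The order drop along a PEEL step -/

/-- `ord` is antitone in the ideal (a public copy of a lemma several tree files keep private). [folklore] -/
theorem idealOrder_antitone {I J : E.IdealSheafData} (h : I ≤ J) (x : E) : idealOrder J x ≤ idealOrder I x := by
  refine ENat.forall_natCast_le_iff_le.mp fun c hc => ?_
  rw [le_idealOrder_iff] at hc ⊢
  exact (stalkIdeal_mono h x).trans hc

/-- In a regular local ring the order function is a valuation: if `M_x = (g)` with `g ∈ 𝔪^w ∖ 𝔪^{w+1}` and `ord_x F = d`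
then `ord_x (M · F) = w + d`. [cite: ZariskiSamuel1960, Ch. VIII §1 Thm. 1] -/
-- adapted from `Literature.AlgebraicGeometry.Hironaka2017.MonomialPart.idealOrder_mul_of_span_singleton` (kept import-light)
theorem idealOrder_mul_of_span_singleton {x : E} [IsRegularLocalRing (E.presheaf.stalk x)] (M F : E.IdealSheafData)
    {g : E.presheaf.stalk x} {w d : ℕ} (hM : stalkIdeal M x = Ideal.span {g})
    (hgw : g ∈ maximalIdeal (E.presheaf.stalk x) ^ w) (hgw' : g ∉ maximalIdeal (E.presheaf.stalk x) ^ (w + 1))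
    (hF : idealOrder F x = d) : idealOrder (M * F) x = ((w + d : ℕ) : ℕ∞) := by
  apply le_antisymm
  · by_contra hlt
    rw [not_le] at hlt
    have hle : (((w + d + 1 : ℕ)) : ℕ∞) ≤ idealOrder (M * F) x :=
      (ENat.add_one_le_iff (ENat.coe_ne_top _)).mpr hlt |>.trans' (by push_cast; exact le_rfl)
    rw [le_idealOrder_iff, stalkIdeal_mul, hM] at hle
    have hnot : ¬ stalkIdeal F x ≤ maximalIdeal (E.presheaf.stalk x) ^ (d + 1) := by
      rw [← le_idealOrder_iff, hF]
      exact_mod_cast Nat.lt_irrefl _ ∘ Nat.lt_of_succ_le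
    obtain ⟨f, hfF, hf⟩ := Set.not_subset.mp hnot
    have hgf : g * f ∈ Ideal.span {g} * stalkIdeal F x :=
      Ideal.mul_mem_mul (Ideal.mem_span_singleton_self g) hfF
    exact mul_not_mem_pow_of_not_mem_pow hgw' hf (hle hgf)
  · rw [le_idealOrder_iff, stalkIdeal_mul, hM, pow_add]
    refine Ideal.mul_mono ((Ideal.span_singleton_le_iff_mem _).mpr hgw) ?_
    rw [← le_idealOrder_iff, hF]

/-- **(B2, orders) `ord_x 𝔟 = m · ord_x S + ord_x J` whenever `S^m · J = 𝔟`**, at a point `x` with regular local ring, for `S`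
an effective Cartier ideal sheaf of (finite) order `w` at `x` and `J` of finite order `d` at `x`: the stalk of `S` is generated
by a non-zero-divisor `t` of order exactly `w`, so `S^m_x = (t^m)` with `t^m` of order exactly `m·w`.
[cite: ZariskiSamuel1960, Ch. VIII §1 Thm. 1] -/
theorem idealOrder_eq_add_of_pow_mul_eq {x : E} [IsRegularLocalRing (E.presheaf.stalk x)] (hS : IsEffectiveCartier S)
    {J : E.IdealSheafData} (hJ : S ^ m * J = 𝔟) {w d : ℕ} (hw : idealOrder S x = w) (hd : idealOrder J x = d) :
    idealOrder 𝔟 x = ((m * w + d : ℕ) : ℕ∞) := by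
  obtain ⟨t, -, ht⟩ := hS.exists_stalkIdeal_eq_span x
  -- `t ∈ 𝔪^w ∖ 𝔪^{w+1}`
  have htw : t ∈ maximalIdeal (E.presheaf.stalk x) ^ w := by
    have h1 : ((w : ℕ) : ℕ∞) ≤ idealOrder S x := hw.ge
    rw [le_idealOrder_iff, ht, Ideal.span_singleton_le_iff_mem] at h1
    exact h1
  have htw' : t ∉ maximalIdeal (E.presheaf.stalk x) ^ (w + 1) := by
    intro h1
    have h2 : (((w + 1 : ℕ)) : ℕ∞) ≤ idealOrder S x := by
      rw [le_idealOrder_iff, ht, Ideal.span_singleton_le_iff_mem]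
      exact h1
    rw [hw] at h2
    exact absurd (by exact_mod_cast h2 : w + 1 ≤ w) (by omega)
  -- `S^m_x = (t^m)` with `t^m` of order exactly `m·w`
  have hSm : stalkIdeal (S ^ m) x = Ideal.span {t ^ m} := by
    rw [stalkIdeal_pow, ht, Ideal.span_singleton_pow]
  have htm : t ^ m ∈ maximalIdeal (E.presheaf.stalk x) ^ (m * w) := by
    rw [mul_comm, pow_mul]
    exact Ideal.pow_mem_pow htw m
  have htm' : t ^ m ∉ maximalIdeal (E.presheaf.stalk x) ^ (m * w + 1) :=
    pow_not_mem_pow_of_not_mem_pow htw' m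
  rw [← hJ]
  exact idealOrder_mul_of_span_singleton (S ^ m) J hSm htm htm' hd

/-- **(B2, order drop) `ord_x (controlledTransform (𝟙 E) S 𝔟 m) = ord_x 𝔟 − m · ord_x S`** (and `m · ord_x S ≤ ord_x 𝔟`) at a
point `x` with regular local ring, for `S` effective Cartier, `𝔟 ≤ S^m` and `ord_x 𝔟` finite (e.g. `𝔟` non-zero on an integral
`E`). [cite: ZariskiSamuel1960, Ch. VIII §1 Thm. 1] [cite: BierstoneGrigorievMilmanWlodarczyk2011, §3.2 Lemma 3.2.1] -/
theorem idealOrder_controlledTransform_id {x : E} [IsRegularLocalRing (E.presheaf.stalk x)] (hS : IsEffectiveCartier S)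
    (h : 𝔟 ≤ S ^ m) {w n : ℕ} (hw : idealOrder S x = w) (hn : idealOrder 𝔟 x = n) :
    idealOrder (controlledTransform (𝟙 E) S 𝔟 m) x = ((n - m * w : ℕ) : ℕ∞) ∧ m * w ≤ n := by
  -- the PEEL transform has finite order `d ≤ n`
  have hle : idealOrder (controlledTransform (𝟙 E) S 𝔟 m) x ≤ n :=
    hn ▸ idealOrder_antitone le_controlledTransform_id x
  obtain ⟨d, hd⟩ : ∃ d : ℕ, idealOrder (controlledTransform (𝟙 E) S 𝔟 m) x = d :=
    Option.ne_none_iff_exists'.mp (ne_top_of_le_ne_top (ENat.coe_ne_top n) hle)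
  have key := idealOrder_eq_add_of_pow_mul_eq hS (pow_mul_controlledTransform_id hS h) hw hd
  rw [hn] at key
  have hk : n = m * w + d := by exact_mod_cast key
  refine ⟨?_, by omega⟩
  rw [hd]
  congr 1
  exact_mod_cast (by omega : d = n - m * w)

/-- **At a point of a REGULAR hypersurface centre the order drops by exactly the weight**: if `ord_x S = 1` (e.g. `S` the ideal of
a regular surface through `x` in the regular threefold `E`), then `ord_x (controlledTransform (𝟙 E) S 𝔟 m) = ord_x 𝔟 − m`.
[cite: ZariskiSamuel1960, Ch. VIII §1 Thm. 1] -/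
theorem idealOrder_controlledTransform_id_of_order_one {x : E} [IsRegularLocalRing (E.presheaf.stalk x)]
    (hS : IsEffectiveCartier S) (h : 𝔟 ≤ S ^ m) (hw : idealOrder S x = 1) {n : ℕ} (hn : idealOrder 𝔟 x = n) :
    idealOrder (controlledTransform (𝟙 E) S 𝔟 m) x = ((n - m : ℕ) : ℕ∞) ∧ m ≤ n := by
  simpa only [mul_one] using idealOrder_controlledTransform_id hS h hw hn

end Summit.ResolutionOfSingularities.ResolutionOfSingularities.Theorems.DepthPeel

end
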